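import Summits.BirchSwinnertonDyer.BirchSwinnertonDyer.Theorems.Rank2Observatory2DescClFamCertQ2Logs
import HarnessLib

/-!
# BirchSwinnertonDyer — rank ≥ 2 observatory: KERNEL-2DESC-CL E2Q2 — the registry core of a two-prime field record (`ClFieldCertQ2.checkReg`), part 1/8

HONEST FRAMING: per-curve certified theorems and census instruments; no claim on BSD in rank ≥ 2.

E2Q2 = the TWO-VIEW (`α`, `η`) field and curve layers of v2.3 (`…2DescClEtaCert`, design `KERNEL-2DESC-CL.md`
§7.4–7.5) over the TWO-AUXILIARY-PRIME field record of Q2 (`ClFieldCertQ2`, `…2DescClFieldCertQ2`): the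
certificate lane for the rank-2 census curves whose complex cubic 2-division field is NON-MONOGENIC (certified:
no presentation `𝓞 K = ℤ[α]` exists, so every single-view curve record is unsatisfiable, §7.5) and has a
NON-CYCLIC class group (two generators, so one auxiliary prime `q = W₁W₂` cannot generate `Cl(K)`).
The Q2 field-level lemmas (`…2DescClFieldCertQ2Sound`) are stated under the full checker `fc.check`, whose
Minkowski sweep runs in the `α`-view alone and therefore FAILS for a non-monogenic presentation (the index primes
of `α` have no `α`-row).  Exactly as v2.3 did for the one-prime record (`ClFieldCert.checkReg`), this file isolates
the REGISTRY CORE `ClFieldCertQ2.checkReg = noRootMod ∧ checkRegistry ∧ checkChars` (no archimedean clause, no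
sweep) and re-derives from it alone, with the Q2 proofs verbatim: irreducibility, the rows, `q₁ ≠ q₂`, the four
ideals `w₁₁ w₁₂` (above `q₁ = W₁₁W₁₂`) and `w₂₁ w₂₂` (above `q₂`) with their covers and distinctness, the residue
characters (`exists_psi_of_reg`), and the complex field clause on its own (`…_of_field`); part 2
(`…2DescClFieldCertQ2RegW`) continues with the four height-one primes, `codePrimeR` and the valuation
computations.  The two-view sweep that replaces `checkSweep` is part 3 (`…2DescClFieldCertE2Q2`).
Sorry-free; new declarations only; axioms `propext`, `Classical.choice`, `Quot.sound`.
[cite: Cohen1993, §4.8.2, §6.2, §6.5] [cite: Marcus2018, Ch. 3, Thm. 22 and Thm. 27; Ch. 5, Thm. 38] [cite: Cassels1991LecturesEllipticCurves, §15]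
-/

set_option linter.dupNamespace false

noncomputable section

open scoped Classical NumberField nonZeroDivisors

open Literature.NumberTheory.NumberFields Polynomial Module NumberField IsDedekindDomain Ideal

namespace Summit.BirchSwinnertonDyer.BirchSwinnertonDyer.Rank2Observatory.TwoDescCl

open TwoDescCubic

/-! ## The registry core -/

namespace ClFieldCertQ2

/-- **Registry core** of a two-prime field record: irreducibility modulo `pIrr`, the rows of `q₁`, `q₂` and the
registry, the residue characters — no archimedean clause, no sweep. Computable. [cite: Cohen1993, §6.5] -/
def checkReg (fc : ClFieldCertQ2) : Bool :=
  noRootMod fc.pIrr fc.a fc.b fc.c && fc.checkRegistry && fc.checkChars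

/-- The full Q2 checker implies the registry core. -/
theorem checkReg_of_check (fc : ClFieldCertQ2) (hF : fc.check = true) : fc.checkReg = true := by
  simp only [check, checkField, checkReg, Bool.and_eq_true] at hF ⊢
  exact ⟨⟨hF.1.1.1.1.1, hF.1.2⟩, hF.2⟩

end ClFieldCertQ2

variable {K : Type*} [Field K] [NumberField K] {θ : K} (fc : ClFieldCertQ2)

namespace ClFieldCertQ2

/-! ### The complex field clause on its own -/

/-- `g` is irreducible (from the field clause). [folklore] -/
theorem irreducible_of_field (fc : ClFieldCertQ2) (hfd : fc.checkField = true) : Irreducible (MonicCubic.polyQ fc.a fc.b fc.c) := by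
  simp only [checkField, Bool.and_eq_true] at hfd
  exact irreducible_of_noRootMod hfd.1.1

/-- `Δ(g) < 0` (from the field clause). [folklore] -/
theorem disc_neg_of_field (fc : ClFieldCertQ2) (hfd : fc.checkField = true) : MonicCubic.disc fc.a fc.b fc.c < 0 := by
  simp only [checkField, Bool.and_eq_true, decide_eq_true_eq] at hfd
  exact hfd.1.2

/-- The interval facts: `0 ≤ lo < hi`, `g(lo) < 0 < g(hi)` (from the field clause). [folklore] -/
theorem interval_of_field (fc : ClFieldCertQ2) (hfd : fc.checkField = true) :
    0 ≤ fc.lo ∧ fc.lo < fc.hi ∧ fc.lo ^ 3 + (fc.a : ℚ) * fc.lo ^ 2 + (fc.b : ℚ) * fc.lo + (fc.c : ℚ) < 0 ∧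
      0 < fc.hi ^ 3 + (fc.a : ℚ) * fc.hi ^ 2 + (fc.b : ℚ) * fc.hi + (fc.c : ℚ) := by
  simp only [checkField, Bool.and_eq_true, decide_eq_true_eq] at hfd
  exact hfd.2

/-- Unit rank `1` (from the field clause). [cite: Marcus2018, Ch. 5, Thm. 38] -/
theorem units_rank_of_field (fc : ClFieldCertQ2) (hθ : aeval θ (MonicCubic.poly fc.a fc.b fc.c) = 0) (h3 : finrank ℚ K = 3)
    (hfd : fc.checkField = true) : NumberField.Units.rank K = 1 :=
  units_rank_eq_one_of_disc_neg (fc.irreducible_of_field hfd) hθ h3 (fc.disc_neg_of_field hfd)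

/-- The real place with `lo < ρ(α) < hi` (from the field clause). [folklore] -/
theorem exists_rho_of_field (fc : ClFieldCertQ2) (hθ : aeval θ (MonicCubic.poly fc.a fc.b fc.c) = 0) (h3 : finrank ℚ K = 3)
    (hfd : fc.checkField = true) : ∃ ρ : K →+* ℝ, ((fc.lo : ℚ) : ℝ) < ρ θ ∧ ρ θ < ((fc.hi : ℚ) : ℝ) := by
  obtain ⟨-, hlt, hlo, hhi⟩ := fc.interval_of_field hfd
  exact exists_real_embedding_of_sign_change (fc.irreducible_of_field hfd) hθ h3 hlt hlo hhi

/-! ### Consequences of the registry core -/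

/-- `g` is irreducible. [folklore] -/
theorem irreducible_of_reg (fc : ClFieldCertQ2) (hR : fc.checkReg = true) : Irreducible (MonicCubic.polyQ fc.a fc.b fc.c) := by
  simp only [checkReg, Bool.and_eq_true] at hR
  exact irreducible_of_noRootMod hR.1.1

/-- Every registry row is checked, and its prime is neither `q₁` nor `q₂`. -/
theorem row_check_of_mem_reg (hR : fc.checkReg = true) {e : PrimeEntry} (he : e ∈ fc.primes) :
    e.check fc.a fc.b fc.c = true ∧ e.p ≠ fc.q₁ ∧ e.p ≠ fc.q₂ := by
  simp only [checkReg, checkRegistry, Bool.and_eq_true, List.all_eq_true] at hR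
  have h := hR.1.2.2 e he
  exact ⟨h.1.1, by simpa using h.1.2, by simpa using h.2⟩

/-- `q₁ ≠ q₂`. -/
theorem q₁_ne_q₂_reg (hR : fc.checkReg = true) : fc.q₁ ≠ fc.q₂ := by
  simp only [checkReg, checkRegistry, Bool.and_eq_true] at hR
  simpa using hR.1.2.1.2

/-- The row of `q₁` is checked. -/
theorem qEntry₁_check_reg (hR : fc.checkReg = true) : fc.qEntry₁.check fc.a fc.b fc.c = true := by
  simp only [checkReg, checkRegistry, Bool.and_eq_true] at hR
  exact hR.1.2.1.1.1

/-- The row of `q₂` is checked. -/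
theorem qEntry₂_check_reg (hR : fc.checkReg = true) : fc.qEntry₂.check fc.a fc.b fc.c = true := by
  simp only [checkReg, checkRegistry, Bool.and_eq_true] at hR
  exact hR.1.2.1.1.2

/-- `W₁₁` is a prime above `q₁` of norm `q₁`. [cite: Cohen1993, §4.8.2] -/
theorem w₁₁_of_reg (hθ : aeval θ (MonicCubic.poly fc.a fc.b fc.c) = 0) (h3 : finrank ℚ K = 3)
    (hR : fc.checkReg = true) (hpr : fc.primeList.Forall Nat.Prime) :
    idealOf hθ fc.w₁₁ ∈ primesOver (span {(fc.q₁ : ℤ)}) (𝓞 K) ∧ absNorm (idealOf hθ fc.w₁₁) = fc.q₁ := by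
  have h := (primeEntry_sound (fc.irreducible_of_reg hR) hθ h3 fc.qEntry₁ (fc.q₁_prime hpr)
    (fc.qEntry₁_check_reg hR)).1 fc.w₁₁ (by rw [qEntry₁_codes]; simp)
  have hdeg : codeDeg fc.w₁₁ = 1 := by simp [codeDeg, w₁₁]
  rw [hdeg, pow_one] at h
  exact h

/-- `W₁₂` is a prime above `q₁` of norm `q₁²`. [cite: Cohen1993, §4.8.2] -/
theorem w₁₂_of_reg (hθ : aeval θ (MonicCubic.poly fc.a fc.b fc.c) = 0) (h3 : finrank ℚ K = 3)
    (hR : fc.checkReg = true) (hpr : fc.primeList.Forall Nat.Prime) :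
    idealOf hθ fc.w₁₂ ∈ primesOver (span {(fc.q₁ : ℤ)}) (𝓞 K) ∧ absNorm (idealOf hθ fc.w₁₂) = fc.q₁ ^ 2 := by
  have h := (primeEntry_sound (fc.irreducible_of_reg hR) hθ h3 fc.qEntry₁ (fc.q₁_prime hpr)
    (fc.qEntry₁_check_reg hR)).1 fc.w₁₂ (by rw [qEntry₁_codes]; simp)
  have hdeg : codeDeg fc.w₁₂ = 2 := by simp [codeDeg, w₁₂]
  rw [hdeg] at h
  exact h

/-- `W₂₁` is a prime above `q₂` of norm `q₂`. [cite: Cohen1993, §4.8.2] -/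
theorem w₂₁_of_reg (hθ : aeval θ (MonicCubic.poly fc.a fc.b fc.c) = 0) (h3 : finrank ℚ K = 3)
    (hR : fc.checkReg = true) (hpr : fc.primeList.Forall Nat.Prime) :
    idealOf hθ fc.w₂₁ ∈ primesOver (span {(fc.q₂ : ℤ)}) (𝓞 K) ∧ absNorm (idealOf hθ fc.w₂₁) = fc.q₂ := by
  have h := (primeEntry_sound (fc.irreducible_of_reg hR) hθ h3 fc.qEntry₂ (fc.q₂_prime hpr)
    (fc.qEntry₂_check_reg hR)).1 fc.w₂₁ (by rw [qEntry₂_codes]; simp)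
  have hdeg : codeDeg fc.w₂₁ = 1 := by simp [codeDeg, w₂₁]
  rw [hdeg, pow_one] at h
  exact h

/-- `W₂₂` is a prime above `q₂` of norm `q₂²`. [cite: Cohen1993, §4.8.2] -/
theorem w₂₂_of_reg (hθ : aeval θ (MonicCubic.poly fc.a fc.b fc.c) = 0) (h3 : finrank ℚ K = 3)
    (hR : fc.checkReg = true) (hpr : fc.primeList.Forall Nat.Prime) :
    idealOf hθ fc.w₂₂ ∈ primesOver (span {(fc.q₂ : ℤ)}) (𝓞 K) ∧ absNorm (idealOf hθ fc.w₂₂) = fc.q₂ ^ 2 := by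
  have h := (primeEntry_sound (fc.irreducible_of_reg hR) hθ h3 fc.qEntry₂ (fc.q₂_prime hpr)
    (fc.qEntry₂_check_reg hR)).1 fc.w₂₂ (by rw [qEntry₂_codes]; simp)
  have hdeg : codeDeg fc.w₂₂ = 2 := by simp [codeDeg, w₂₂]
  rw [hdeg] at h
  exact h

/-- Every prime containing `q₁` is `W₁₁` or `W₁₂`. [cite: Cohen1993, §4.8.2, Thm. 4.8.13] -/
theorem qcover₁_of_reg (hθ : aeval θ (MonicCubic.poly fc.a fc.b fc.c) = 0) (h3 : finrank ℚ K = 3)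
    (hR : fc.checkReg = true) (hpr : fc.primeList.Forall Nat.Prime) (P : Ideal (𝓞 K)) (hP : P.IsPrime)
    (hq : (fc.q₁ : 𝓞 K) ∈ P) : P = idealOf hθ fc.w₁₁ ∨ P = idealOf hθ fc.w₁₂ := by
  obtain ⟨C, hC, rfl⟩ := (primeEntry_sound (fc.irreducible_of_reg hR) hθ h3 fc.qEntry₁ (fc.q₁_prime hpr)
    (fc.qEntry₁_check_reg hR)).2 P hP hq
  rw [qEntry₁_codes] at hC
  simp only [List.mem_cons, List.not_mem_nil, or_false] at hC
  rcases hC with rfl | rfl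
  · exact Or.inl rfl
  · exact Or.inr rfl

/-- Every prime containing `q₂` is `W₂₁` or `W₂₂`. [cite: Cohen1993, §4.8.2, Thm. 4.8.13] -/
theorem qcover₂_of_reg (hθ : aeval θ (MonicCubic.poly fc.a fc.b fc.c) = 0) (h3 : finrank ℚ K = 3)
    (hR : fc.checkReg = true) (hpr : fc.primeList.Forall Nat.Prime) (P : Ideal (𝓞 K)) (hP : P.IsPrime)
    (hq : (fc.q₂ : 𝓞 K) ∈ P) : P = idealOf hθ fc.w₂₁ ∨ P = idealOf hθ fc.w₂₂ := by
  obtain ⟨C, hC, rfl⟩ := (primeEntry_sound (fc.irreducible_of_reg hR) hθ h3 fc.qEntry₂ (fc.q₂_prime hpr)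
    (fc.qEntry₂_check_reg hR)).2 P hP hq
  rw [qEntry₂_codes] at hC
  simp only [List.mem_cons, List.not_mem_nil, or_false] at hC
  rcases hC with rfl | rfl
  · exact Or.inl rfl
  · exact Or.inr rfl

/-- `W₁₁ ≠ W₁₂` (different norms). [folklore] -/
theorem w₁₁_ne_w₁₂_reg (hθ : aeval θ (MonicCubic.poly fc.a fc.b fc.c) = 0) (h3 : finrank ℚ K = 3)
    (hR : fc.checkReg = true) (hpr : fc.primeList.Forall Nat.Prime) :
    idealOf hθ fc.w₁₁ ≠ idealOf hθ fc.w₁₂ := by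
  intro h
  have h₁ := (fc.w₁₁_of_reg hθ h3 hR hpr).2
  have h₂ := (fc.w₁₂_of_reg hθ h3 hR hpr).2
  rw [h, h₂] at h₁
  have hq := (fc.q₁_prime hpr).one_lt
  have : fc.q₁ ^ 2 = fc.q₁ ^ 1 := by rw [pow_one]; exact h₁
  exact absurd (Nat.pow_right_injective hq this) (by norm_num)

/-- `W₂₁ ≠ W₂₂` (different norms). [folklore] -/
theorem w₂₁_ne_w₂₂_reg (hθ : aeval θ (MonicCubic.poly fc.a fc.b fc.c) = 0) (h3 : finrank ℚ K = 3)
    (hR : fc.checkReg = true) (hpr : fc.primeList.Forall Nat.Prime) :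
    idealOf hθ fc.w₂₁ ≠ idealOf hθ fc.w₂₂ := by
  intro h
  have h₁ := (fc.w₂₁_of_reg hθ h3 hR hpr).2
  have h₂ := (fc.w₂₂_of_reg hθ h3 hR hpr).2
  rw [h, h₂] at h₁
  have hq := (fc.q₂_prime hpr).one_lt
  have : fc.q₂ ^ 2 = fc.q₂ ^ 1 := by rw [pow_one]; exact h₁
  exact absurd (Nat.pow_right_injective hq this) (by norm_num)

omit [NumberField K] in
/-- A prime containing `q₁` does not contain `q₂` (else it contains `1`). [folklore] -/
theorem not_mem_of_mem_q₁_reg (hR : fc.checkReg = true) (hpr : fc.primeList.Forall Nat.Prime)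
    {P : Ideal (𝓞 K)} (hP : P.IsPrime) (h₁ : (fc.q₁ : 𝓞 K) ∈ P) : (fc.q₂ : 𝓞 K) ∉ P := by
  intro h₂
  have hcop : Nat.Coprime fc.q₁ fc.q₂ :=
    (Nat.coprime_primes (fc.q₁_prime hpr) (fc.q₂_prime hpr)).mpr (fc.q₁_ne_q₂_reg hR)
  have hgcd := Nat.gcd_eq_gcd_ab fc.q₁ fc.q₂
  rw [Nat.Coprime.gcd_eq_one hcop] at hgcd
  have h1 : (1 : 𝓞 K) ∈ P := by
    have : ((1 : ℕ) : ℤ) = (fc.q₁ : ℤ) * Nat.gcdA fc.q₁ fc.q₂ + (fc.q₂ : ℤ) * Nat.gcdB fc.q₁ fc.q₂ := hgcd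
    have hcast : (1 : 𝓞 K) = (fc.q₁ : 𝓞 K) * (Nat.gcdA fc.q₁ fc.q₂ : 𝓞 K) +
        (fc.q₂ : 𝓞 K) * (Nat.gcdB fc.q₁ fc.q₂ : 𝓞 K) := by
      have := congrArg (fun z : ℤ => (z : 𝓞 K)) this
      push_cast at this
      exact this
    rw [hcast]
    exact P.add_mem (P.mul_mem_right _ h₁) (P.mul_mem_right _ h₂)
  exact hP.ne_top ((Ideal.eq_top_iff_one P).mpr h1)

/-- **The residue map `ψ_{ℓ,t} : 𝓞 K → ℤ/ℓ`, `α ↦ t`**, for every character row, with `ℓ` an odd prime.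
[cite: Marcus2018, Ch. 3, Thm. 27] -/
theorem exists_psi_of_reg (fc : ClFieldCertQ2) (hθ : aeval θ (MonicCubic.poly fc.a fc.b fc.c) = 0) (h3 : finrank ℚ K = 3)
    (hR : fc.checkReg = true) (hpr : fc.primeList.Forall Nat.Prime) {ch : ℕ × ℤ × ℤ} (hch : ch ∈ fc.chars) :
    2 < ch.1 ∧ ∃ ψ : 𝓞 K →+* ZMod ch.1, ψ (MonicCubic.thetaInt hθ) = ((ch.2.1 : ℤ) : ZMod ch.1) := by
  have hirr := fc.irreducible_of_reg hR
  simp only [checkReg, checkChars, Bool.and_eq_true, decide_eq_true_eq, List.all_eq_true] at hR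
  obtain ⟨⟨h2, hroot⟩, hinv⟩ := hR.2 ch hch
  obtain ⟨ℓ, t, dinv⟩ := ch
  simp only at h2 hroot hinv ⊢
  have hℓ : ℓ.Prime := fc.char_prime hpr hch
  haveI : NeZero ℓ := ⟨hℓ.ne_zero⟩
  refine ⟨h2, MonicCubic.exists_ringHom_of_root_of_mul_mem hirr hθ h3 (natAbs_disc_mul_mem_adjoin hirr hθ h3)
    ((t : ℤ) : ZMod ℓ) ?_ ((dinv : ℤ) : ZMod ℓ) ?_⟩
  · have h0 := (ZMod.intCast_zmod_eq_zero_iff_dvd _ ℓ).mpr (Int.dvd_of_emod_eq_zero hroot)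
    push_cast at h0
    exact h0
  · have h1 : ((((MonicCubic.disc fc.a fc.b fc.c).natAbs : ℤ) * dinv : ℤ) : ZMod ℓ) = ((1 : ℤ) : ZMod ℓ) := by
      rw [ZMod.intCast_eq_intCast_iff', hinv, Int.emod_eq_of_lt (by norm_num) (by have := hℓ.one_lt; omega)]
    simp only [Int.cast_mul, Int.cast_natCast, Int.cast_one] at h1
    exact h1

end ClFieldCertQ2

end Summit.BirchSwinnertonDyer.BirchSwinnertonDyer.Rank2Observatory.TwoDescCl
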